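import Summits.BirchSwinnertonDyer.BirchSwinnertonDyer.Theorems.KimAtThreeDeepLowerOffStratumLevelLoweringConditionOne
import Summits.BirchSwinnertonDyer.BirchSwinnertonDyer.Theorems.KimAtThreeDeepLowerOffStratumLevelLoweringStabEigenform
import HarnessLib

/-!
# Route `KimAtThreeKolyvagin` (rung W2), crux `DeepLowerAtThreeOffKatoStratum` (item 19679), registered
# stub `stub_nonAdditive`, ROAD (b²): Vatsal's Condition 1 for the DOUBLE stabilisation
# `h = (ι₁ − β ι_q)(ι₁ − β′ ι_ℓ) g` of a newform `g` (two primes `q ≠ ℓ` off the level, `α ≠ β`, `α′ ≠ β′`)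

Cell `bsd-addord`, seat `bsd-addord-w2-acc2` (PROGRAMME PART 1b, ACCEL-LIST row (2)), gen 5; item
`stmt-BirchSwinnertonDyer-19679` (OWNER w2-c2 assembles; `--supports`, closes nothing). Second file of ROAD (b²)
(the 8 107 semistable depth-`1` rows with exactly ONE extra prime `ℓ` at which `ρ̄_{E,3}` is unramified or finite:
the comparison form for Vatsal's congruence is the double stabilisation of the optimal-level newform). As in
`…ConditionOne` §2 (one prime): a generalised eigenvector for the eigencharacter of `h` is an honest
`T_p`-eigenvector off the level (`heckeT_apply_eq_smul_of_pow_apply_eq_zero`), hence (Atkin–Lehner basis + strong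
multiplicity one across levels) lies in the `(q, ℓ)`-old space of `g`, spanned by `ι_d g`, `d ∣ qℓ`; that space is
spanned by the FOUR double stabilisations `h_{s,t}` (`s ∈ {β, α}`, `t ∈ {β′, α′}`), simultaneous eigenvectors of
`U_q` (eigenvalue `a_q − s`) and `U_ℓ` (`a_ℓ − t`); powers of `U_q − α` and `U_ℓ − α′` kill all but `h = h_{β,β′}`.
Theorems only; no definition, no fact, no `sorry`.

* §1 `iota_iota` (`ι_d ∘ ι_{d′} = ι_{dd′}` on `q`-expansions); the old forms `ι_d g`, `d ∣ qℓ`, inside the span of the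
  four `h_{s,t}`.
* §2 ★ `hasSimpleHeckeGenEigenspace_doubleStab_of_ne`.

## References

* V. Vatsal, Duke Math. J. 98 (1999), (1.2) Condition 1. [Vatsal1999]
* A. O. L. Atkin, J. Lehner, Math. Ann. 185 (1970), Thm. 4, Thm. 5. [AtkinLehner1970]
* F. Diamond, J. Shurman (2005), Prop. 5.6.2, Thm. 5.8.3. [DiamondShurman2005]
-/

set_option autoImplicit false
-- the Theorems namespace of a single-conjunct summit repeats the summit name by design (D-0017)
set_option linter.dupNamespace false

noncomputable section

open scoped MatrixGroups ModularForm Classical NNReal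

open CongruenceSubgroup WeierstrassCurve Literature.NumberTheory.EllipticCurves
  Literature.NumberTheory.EllipticCurves.ModularForms
open UpperHalfPlane hiding I

namespace Summit.BirchSwinnertonDyer.BirchSwinnertonDyer.Theorems.KimAtThreeDeepLowerOffStratumLevelLoweringDoubleStabConditionOne

open Summit.BirchSwinnertonDyer.BirchSwinnertonDyer.Theorems.KimAtThreeDeepLowerOffStratumLevelLoweringConditionOne
open Summit.BirchSwinnertonDyer.BirchSwinnertonDyer.Theorems.KimAtThreeDeepLowerOffStratumLevelLoweringVatsalStab
open Summit.BirchSwinnertonDyer.BirchSwinnertonDyer.Theorems.KimAtThreeDeepLowerOffStratumLevelLoweringStabEigenform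
  renaming heckeT_stab_of_ne → heckeT_stab_of_ne_eig, heckeT_stab_self → heckeT_stab_self_eig,
    isHeckeEigenform_stab → isHeckeEigenform_stab_eig, cuspCoeff_stab_prime → cuspCoeff_stab_prime_eig,
    cuspCoeff_mul_cuspCoeff → cuspCoeff_mul_cuspCoeff_eig, heckeEigenvalue_stab → heckeEigenvalue_stab_eig

/-! ### §1 `ι_d ∘ ι_{d′} = ι_{dd′}` and the `(q, ℓ)`-old forms of `g` -/

section Iota

variable {L M N d e : ℕ} [NeZero L] [NeZero M] [NeZero N] [NeZero d] [NeZero e] {k : ℤ}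

omit [NeZero L] [NeZero M] [NeZero N] in
/-- **`ι_d (ι_e f) = ι_{ed} f`** (compare `q`-expansions: `a_n(ι_d φ) = 𝟙_{d ∣ n} a_{n/d}(φ)`). [cite: DiamondShurman2005, §5.7 (ι_d on Fourier expansions)] -/
theorem iota_iota [NeZero (e * d)] (hLM : L * e ∣ M) (hMN : M * d ∣ N) (hLN : L * (e * d) ∣ N) (f : CuspForm (Gamma0 L) k) :
    iota M N d k hMN (iota L M e k hLM f) = iota L N (e * d) k hLN f := by
  refine eq_of_forall_cuspCoeff_eq_gamma0 fun n ↦ ?_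
  simp only [cuspCoeff, qExpansion_coeff_iota]
  by_cases hd : d ∣ n
  · obtain ⟨m, rfl⟩ := hd
    rw [if_pos (dvd_mul_right d m), Nat.mul_div_cancel_left m (NeZero.pos d)]
    by_cases he : e ∣ m
    · obtain ⟨r, rfl⟩ := he
      rw [if_pos (dvd_mul_right e r), Nat.mul_div_cancel_left r (NeZero.pos e),
        if_pos ⟨r, by ring⟩, show d * (e * r) = (e * d) * r by ring, Nat.mul_div_cancel_left r (NeZero.pos (e * d))]
    · rw [if_neg he, if_neg]
      rintro ⟨r, hr⟩
      exact he ⟨r, Nat.eq_of_mul_eq_mul_left (NeZero.pos d) (by rw [hr]; ring)⟩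
  · rw [if_neg hd, if_neg]
    rintro ⟨r, hr⟩
    exact hd ⟨e * r, by rw [hr]; ring⟩

end Iota

/-! ### §2 Condition 1 for the double stabilisation -/

section Double

variable {M₀ ℓ q : ℕ} [NeZero M₀] [NeZero ℓ] [NeZero q] [NeZero (M₀ * ℓ)] [NeZero (M₀ * ℓ * q)]
  {g : CuspForm (Gamma0 M₀) 2} (hg : IsNewform0 g)
  (hℓ₁ : M₀ * 1 ∣ M₀ * ℓ) (hℓℓ : M₀ * ℓ ∣ M₀ * ℓ) (hq₁ : M₀ * ℓ * 1 ∣ M₀ * ℓ * q) (hqq : M₀ * ℓ * q ∣ M₀ * ℓ * q)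
include hg

/-- ★ **Vatsal's Condition 1 for the double stabilisation** `h = ι₁ g′ − β ι_q g′`, `g′ = ι₁ g − β′ ι_ℓ g`, of a newform
`g ∈ S₂(Γ₀(M₀))` at two distinct primes `ℓ ∤ M₀`, `q ∤ M₀ℓ`, with `β′² − a_ℓ(g)β′ + ℓ = 0`, `β² − a_q(g)β + q = 0` and
BOTH pairs of roots distinct (`a_ℓ(g) − β′ ≠ β′`, `a_q(g) − β ≠ β`). [cite: Vatsal1999, (1.2) Condition 1]
[cite: AtkinLehner1970, Thm. 4 and Thm. 5] [cite: DiamondShurman2005, Prop. 5.6.2 and Thm. 5.8.3] -/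
theorem hasSimpleHeckeGenEigenspace_doubleStab_of_ne (hℓ : ℓ.Prime) (hℓM : ¬ ℓ ∣ M₀) (hq : q.Prime)
    (hqM : ¬ q ∣ M₀ * ℓ) {β' β : ℂ} (hβ' : β' ^ 2 - cuspCoeff g ℓ * β' + ℓ = 0) (hβ : β ^ 2 - cuspCoeff g q * β + q = 0)
    (hne' : cuspCoeff g ℓ - β' ≠ β') (hne : cuspCoeff g q - β ≠ β) :
    HasSimpleHeckeGenEigenspace
      (iota (M₀ * ℓ) (M₀ * ℓ * q) 1 2 hq₁ (iota M₀ (M₀ * ℓ) 1 2 hℓ₁ g - β' • iota M₀ (M₀ * ℓ) ℓ 2 hℓℓ g) -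
        β • iota (M₀ * ℓ) (M₀ * ℓ * q) q 2 hqq (iota M₀ (M₀ * ℓ) 1 2 hℓ₁ g - β' • iota M₀ (M₀ * ℓ) ℓ 2 hℓℓ g)) := by
  -- notation: `G t = ι₁ g − t ι_ℓ g` (level `M₀ℓ`), `H s t = ι₁ (G t) − s ι_q (G t)` (level `M₀ℓq`)
  set α' : ℂ := cuspCoeff g ℓ - β' with hα'def
  set α : ℂ := cuspCoeff g q - β with hαdef
  have hqℓ : q ≠ ℓ := by rintro rfl; exact hqM (dvd_mul_left q M₀)
  have hqM₀ : ¬ q ∣ M₀ := fun h ↦ hqM (h.mul_right ℓ)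
  let G : ℂ → CuspForm (Gamma0 (M₀ * ℓ)) 2 := fun t ↦ iota M₀ (M₀ * ℓ) 1 2 hℓ₁ g - t • iota M₀ (M₀ * ℓ) ℓ 2 hℓℓ g
  let H : ℂ → ℂ → CuspForm (Gamma0 (M₀ * ℓ * q)) 2 := fun s t ↦
    iota (M₀ * ℓ) (M₀ * ℓ * q) 1 2 hq₁ (G t) - s • iota (M₀ * ℓ) (M₀ * ℓ * q) q 2 hqq (G t)
  change HasSimpleHeckeGenEigenspace (H β β')
  -- roots
  have hα' : α' ^ 2 - cuspCoeff g ℓ * α' + ℓ = 0 := by rw [hα'def]; linear_combination hβ'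
  have hα : α ^ 2 - cuspCoeff g q * α + q = 0 := by rw [hαdef]; linear_combination hβ
  have root' : ∀ t, t = β' ∨ t = α' → t ^ 2 - cuspCoeff g ℓ * t + ℓ = 0 := by
    rintro t (rfl | rfl); exacts [hβ', hα']
  have root : ∀ s, s = β ∨ s = α → s ^ 2 - cuspCoeff g q * s + q = 0 := by
    rintro s (rfl | rfl); exacts [hβ, hα]
  -- `G t` is a normalised eigenform with `a_q(G t) = a_q(g)`, `a_ℓ(G t) = a_ℓ(g) − t`, `a_p(G t) = a_p(g)` else
  have hGeig : ∀ t, t = β' ∨ t = α' → IsHeckeEigenform (G t) := fun t ht ↦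
    isHeckeEigenform_stab hg t hℓ₁ hℓℓ hℓ hℓM (root' t ht)
  have hGnorm : ∀ t, IsNormalized (G t) := fun t ↦ isNormalized_stab g t hℓ₁ hℓℓ hg.2.2 hℓ
  have hGcoeff : ∀ t, ∀ {p : ℕ}, p.Prime → cuspCoeff (G t) p = if p = ℓ then cuspCoeff g ℓ - t else cuspCoeff g p :=
    fun t p hp ↦ cuspCoeff_stab_prime hg t hℓ₁ hℓℓ hℓ hp
  have hGq : ∀ t, cuspCoeff (G t) q = cuspCoeff g q := fun t ↦ by rw [hGcoeff t hq, if_neg hqℓ]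
  -- eigen-equations of `H s t`
  have hUq : ∀ s t, t = β' ∨ t = α' → s = β ∨ s = α →
      heckeT (Gamma0 (M₀ * ℓ * q)) 2 q (H s t) = (cuspCoeff g q - s) • H s t := by
    intro s t ht hs
    have h := heckeT_stab_self_eig (hGeig t ht) (hGnorm t) s hq₁ hqq hq hqM (by rw [hGq]; exact root s hs)
    rw [hGq] at h
    exact h
  have hUℓ : ∀ s t, t = β' ∨ t = α' → s = β ∨ s = α →
      heckeT (Gamma0 (M₀ * ℓ * q)) 2 ℓ (H s t) = (cuspCoeff g ℓ - t) • H s t := by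
    intro s t ht hs
    have h := heckeT_stab_of_ne_eig (hGeig t ht) (hGnorm t) s hq₁ hqq hq hℓ hqℓ.symm
    rw [hGcoeff t hℓ, if_pos rfl] at h
    exact h
  have hTp : ∀ s t, t = β' ∨ t = α' → s = β ∨ s = α → ∀ {p : ℕ} [NeZero p], p.Prime → p ≠ q → p ≠ ℓ →
      heckeT (Gamma0 (M₀ * ℓ * q)) 2 p (H s t) = cuspCoeff g p • H s t := by
    intro s t ht hs p _ hp hpq hpℓ
    have h := heckeT_stab_of_ne_eig (hGeig t ht) (hGnorm t) s hq₁ hqq hq hp hpq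
    rw [hGcoeff t hp, if_neg hpℓ] at h
    exact h
  have hH0 : ∀ s t, H s t ≠ 0 := fun s t ↦ (isNormalized_stab (G t) s hq₁ hqq (hGnorm t) hq).ne_zero
  -- eigenvalues of `h = H β β'`
  have hev : ∀ {p : ℕ}, p.Prime → heckeEigenvalue (H β β') p =
      if p = q then cuspCoeff g q - β else if p = ℓ then cuspCoeff g ℓ - β' else cuspCoeff g p := by
    intro p hp
    rw [heckeEigenvalue_stab_eig (hGeig β' (Or.inl rfl)) (hGnorm β') β hq₁ hqq hq hqM
      (by rw [hGq]; exact hβ) hp, hGq, hGcoeff β' hp]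
  -- the claim
  intro k hk
  by_cases hk0 : k = 0
  · exact ⟨0, by rw [hk0, zero_smul]⟩
  -- off `M₀ℓq`: honest eigen-equations with eigenvalues `a_p(g)`
  have hT : ∀ (p : ℕ) (hp : p.Prime), ¬ p ∣ M₀ * ℓ * q →
      (haveI : NeZero p := ⟨hp.ne_zero⟩; heckeT (Gamma0 (M₀ * ℓ * q)) 2 p k) = (qExpansion 1 ⇑g).coeff p • k := by
    intro p hp hpN
    haveI : NeZero p := ⟨hp.ne_zero⟩
    have hpq : p ≠ q := by rintro rfl; exact hpN (dvd_mul_left p _)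
    have hpℓ : p ≠ ℓ := by rintro rfl; exact hpN ((dvd_mul_left p M₀).mul_right q)
    obtain ⟨n, hn⟩ := hk p hp
    rw [hev hp, if_neg hpq, if_neg hpℓ] at hn
    exact heckeT_apply_eq_smul_of_pow_apply_eq_zero hp hpN hn
  obtain ⟨M', _, hM'N, g₁, hg₁, hcoef, hmem⟩ := exists_isNewform0_mem_span_of_eigenpacket hk0 hT
  have hfg : ∀ p : ℕ, p.Prime → ¬ p ∣ M₀ * ℓ * q → heckeEigenvalue g p = heckeEigenvalue g₁ p := by
    intro p hp hpN
    rw [heckeEigenvalue_eq_coeff_of_isNormalized hg.2.2 hp (hg.2.1 p hp),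
      heckeEigenvalue_eq_coeff_of_isNormalized hg₁.2.2 hp (hg₁.2.1 p hp), hcoef p hp hpN]
  have hfin : {p : ℕ | p.Prime ∧ heckeEigenvalue g p ≠ heckeEigenvalue g₁ p}.Finite :=
    finite_setOf_prime_and_ne (NeZero.ne (M₀ * ℓ * q)) hfg
  have hMM' : M₀ = M' := IsNewform0.level_eq_of_heckeEigenvalue_eq_holds hg hg₁ hfin
  subst hMM'
  have hg₁g : g₁ = g := (IsNewform0.eq_of_heckeEigenvalue_eq_holds hg hg₁ hfin).symm
  rw [hg₁g] at hmem
  -- the `(q, ℓ)`-old forms of `g` lie in the span `P` of the four `H s t`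
  set P : Submodule ℂ (CuspForm (Gamma0 (M₀ * ℓ * q)) 2) :=
    Submodule.span ℂ (Set.range ![H β β', H β α', H α β', H α α']) with hPdef
  have hP : ∀ i, (![H β β', H β α', H α β', H α α'] : Fin 4 → _) i ∈ P := fun i ↦
    Submodule.subset_span ⟨i, rfl⟩
  have hP0 : H β β' ∈ P := hP 0
  have hP1 : H β α' ∈ P := hP 1
  have hP2 : H α β' ∈ P := hP 2
  have hP3 : H α α' ∈ P := hP 3
  have hαβ : α - β ≠ 0 := sub_ne_zero.mpr hne
  have hαβ' : α' - β' ≠ 0 := sub_ne_zero.mpr hne'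
  -- `ι_q (G t) ∈ P`
  have hιqG : ∀ t, t = β' ∨ t = α' → iota (M₀ * ℓ) (M₀ * ℓ * q) q 2 hqq (G t) ∈ P := by
    intro t ht
    have hdiff : H β t - H α t = (α - β) • iota (M₀ * ℓ) (M₀ * ℓ * q) q 2 hqq (G t) := by
      change (iota _ _ 1 2 hq₁ (G t) - β • iota _ _ q 2 hqq (G t)) - (iota _ _ 1 2 hq₁ (G t) - α • iota _ _ q 2 hqq (G t)) = _
      rw [sub_sub_sub_cancel_left, ← sub_smul]
    have he : iota (M₀ * ℓ) (M₀ * ℓ * q) q 2 hqq (G t) = (α - β)⁻¹ • (H β t - H α t) := by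
      rw [hdiff, smul_smul, inv_mul_cancel₀ hαβ, one_smul]
    rw [he]
    rcases ht with rfl | rfl
    · exact P.smul_mem _ (P.sub_mem hP0 hP2)
    · exact P.smul_mem _ (P.sub_mem hP1 hP3)
  -- `ι₁ (G t) ∈ P`
  have hι1G : ∀ t, t = β' ∨ t = α' → iota (M₀ * ℓ) (M₀ * ℓ * q) 1 2 hq₁ (G t) ∈ P := by
    intro t ht
    have he : iota (M₀ * ℓ) (M₀ * ℓ * q) 1 2 hq₁ (G t) = H β t + β • iota (M₀ * ℓ) (M₀ * ℓ * q) q 2 hqq (G t) := by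
      change _ = (iota _ _ 1 2 hq₁ (G t) - β • iota _ _ q 2 hqq (G t)) + _
      rw [sub_add_cancel]
    rw [he]
    rcases ht with rfl | rfl
    · exact P.add_mem hP0 (P.smul_mem _ (hιqG _ (Or.inl rfl)))
    · exact P.add_mem hP1 (P.smul_mem _ (hιqG _ (Or.inr rfl)))
  -- `G β' − G α' = (α' − β') ι_ℓ g`, so `ι_d (ι_ℓ g) ∈ P` and `ι_d (ι₁ g) ∈ P` for `d ∈ {1, q}`
  have hGdiff : G β' - G α' = (α' - β') • iota M₀ (M₀ * ℓ) ℓ 2 hℓℓ g := by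
    change (iota _ _ 1 2 hℓ₁ g - β' • iota _ _ ℓ 2 hℓℓ g) - (iota _ _ 1 2 hℓ₁ g - α' • iota _ _ ℓ 2 hℓℓ g) = _
    rw [sub_sub_sub_cancel_left, ← sub_smul]
  have hιℓ : iota M₀ (M₀ * ℓ) ℓ 2 hℓℓ g = (α' - β')⁻¹ • (G β' - G α') := by
    rw [hGdiff, smul_smul, inv_mul_cancel₀ hαβ', one_smul]
  have hι1 : iota M₀ (M₀ * ℓ) 1 2 hℓ₁ g = G β' + β' • iota M₀ (M₀ * ℓ) ℓ 2 hℓℓ g := by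
    change _ = (iota _ _ 1 2 hℓ₁ g - β' • iota _ _ ℓ 2 hℓℓ g) + _
    rw [sub_add_cancel]
  have hmemℓ : ∀ {d : ℕ} [NeZero d] (hd : M₀ * ℓ * d ∣ M₀ * ℓ * q),
      (∀ t, t = β' ∨ t = α' → iota (M₀ * ℓ) (M₀ * ℓ * q) d 2 hd (G t) ∈ P) →
      iota (M₀ * ℓ) (M₀ * ℓ * q) d 2 hd (iota M₀ (M₀ * ℓ) ℓ 2 hℓℓ g) ∈ P ∧
      iota (M₀ * ℓ) (M₀ * ℓ * q) d 2 hd (iota M₀ (M₀ * ℓ) 1 2 hℓ₁ g) ∈ P := by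
    intro d _ hd hGd
    have h1 : iota (M₀ * ℓ) (M₀ * ℓ * q) d 2 hd (iota M₀ (M₀ * ℓ) ℓ 2 hℓℓ g) ∈ P := by
      rw [hιℓ, map_smul, map_sub]
      exact P.smul_mem _ (P.sub_mem (hGd _ (Or.inl rfl)) (hGd _ (Or.inr rfl)))
    refine ⟨h1, ?_⟩
    rw [hι1, map_add, map_smul]
    exact P.add_mem (hGd _ (Or.inl rfl)) (P.smul_mem _ h1)
  -- the old forms `[α_d] g₁`, `M₀ d ∣ M₀ ℓ q`
  have hle : Submodule.span ℂ
      {v | ∃ (d : ℕ) (_ : NeZero d), M₀ * d ∣ M₀ * ℓ * q ∧ v = degeneracyMap0 M₀ (M₀ * ℓ * q) d 2 g} ≤ P := by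
    refine Submodule.span_le.mpr ?_
    rintro _ ⟨d, _, hd, rfl⟩
    rw [SetLike.mem_coe, degeneracyMap0_eq_smul_iota M₀ (M₀ * ℓ * q) d 2 hd]
    refine P.smul_mem _ ?_
    have hdqℓ : d ∣ ℓ * q := Nat.dvd_of_mul_dvd_mul_left (NeZero.pos M₀) (by rw [← mul_assoc]; exact hd)
    -- `d ∈ {1, ℓ, q, ℓq}`
    have hcases : d = 1 ∨ d = ℓ ∨ d = q ∨ d = ℓ * q := by
      rcases (Nat.dvd_mul.mp hdqℓ) with ⟨y, z, hy, hz, rfl⟩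
      rcases (Nat.dvd_prime hℓ).mp hy with rfl | rfl <;> rcases (Nat.dvd_prime hq).mp hz with rfl | rfl
      · left; rfl
      · right; right; left; rw [one_mul]
      · right; left; rw [mul_one]
      · right; right; right; rfl
    have h11 : M₀ * ℓ * 1 ∣ M₀ * ℓ * q := hq₁
    rcases hcases with hd1 | hdℓ | hdq | hdℓq
    · -- `d = 1`: `ι₁ g = ι₁ (ι₁ g)`
      haveI : NeZero (1 * 1) := ⟨by norm_num⟩
      have hd' : M₀ * (1 * 1) ∣ M₀ * ℓ * q := ⟨ℓ * q, by ring⟩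
      rw [iota_congr (show d = 1 * 1 by rw [hd1]) hd hd' g,
        ← iota_iota (L := M₀) (M := M₀ * ℓ) (e := 1) (d := 1) hℓ₁ h11 hd' g]
      exact (hmemℓ h11 hι1G).2
    · -- `d = ℓ`: `ι_ℓ g = ι₁ (ι_ℓ g)`
      haveI : NeZero (ℓ * 1) := ⟨by rw [mul_one]; exact NeZero.ne ℓ⟩
      have hd' : M₀ * (ℓ * 1) ∣ M₀ * ℓ * q := ⟨q, by ring⟩
      rw [iota_congr (show d = ℓ * 1 by rw [hdℓ, mul_one]) hd hd' g,
        ← iota_iota (L := M₀) (M := M₀ * ℓ) (e := ℓ) (d := 1) hℓℓ h11 hd' g]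
      exact (hmemℓ h11 hι1G).1
    · -- `d = q`: `ι_q g = ι_q (ι₁ g)`
      haveI : NeZero (1 * q) := ⟨by rw [one_mul]; exact NeZero.ne q⟩
      have hd' : M₀ * (1 * q) ∣ M₀ * ℓ * q := ⟨ℓ, by ring⟩
      rw [iota_congr (show d = 1 * q by rw [hdq, one_mul]) hd hd' g,
        ← iota_iota (L := M₀) (M := M₀ * ℓ) (e := 1) (d := q) hℓ₁ hqq hd' g]
      exact (hmemℓ hqq hιqG).2
    · -- `d = ℓq`: `ι_{ℓq} g = ι_q (ι_ℓ g)`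
      haveI : NeZero (ℓ * q) := ⟨mul_ne_zero (NeZero.ne ℓ) (NeZero.ne q)⟩
      have hd' : M₀ * (ℓ * q) ∣ M₀ * ℓ * q := ⟨1, by ring⟩
      rw [iota_congr hdℓq hd hd' g, ← iota_iota (L := M₀) (M := M₀ * ℓ) (e := ℓ) (d := q) hℓℓ hqq hd' g]
      exact (hmemℓ hqq hιqG).1
  -- coordinates of `k` on the four `H s t`
  obtain ⟨c, hc⟩ := (Submodule.mem_span_range_iff_exists_fun ℂ).mp (hle hmem)
  simp only [Fin.sum_univ_four, Matrix.cons_val_zero, Matrix.cons_val_one, Matrix.head_cons, Matrix.cons_val_two,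
    Matrix.tail_cons, Matrix.cons_val_three] at hc
  -- powers of `U_q − α` and `U_ℓ − α′` on the four eigenvectors
  obtain ⟨n, hn⟩ := hk q hq
  obtain ⟨m, hm⟩ := hk ℓ hℓ
  rw [hev hq, if_pos rfl] at hn
  rw [hev hℓ, if_neg hqℓ.symm, if_pos rfl] at hm
  rcases Nat.eq_zero_or_pos n with rfl | hnpos
  · rw [pow_zero, Module.End.one_apply] at hn; exact absurd hn hk0
  rcases Nat.eq_zero_or_pos m with rfl | hmpos
  · rw [pow_zero, Module.End.one_apply] at hm; exact absurd hm hk0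
  have powq : ∀ s t, t = β' ∨ t = α' → s = β ∨ s = α →
      ((heckeT (Gamma0 (M₀ * ℓ * q)) 2 q -
        (cuspCoeff g q - β) • (1 : Module.End ℂ (CuspForm (Gamma0 (M₀ * ℓ * q)) 2))) ^ n) (H s t) =
        (β - s) ^ n • H s t := by
    intro s t ht hs
    rw [pow_sub_smul_one_apply_of_eigen _ (hUq s t ht hs) _ n,
      show cuspCoeff g q - s - (cuspCoeff g q - β) = β - s by ring]
  have powℓ : ∀ s t, t = β' ∨ t = α' → s = β ∨ s = α →
      ((heckeT (Gamma0 (M₀ * ℓ * q)) 2 ℓ -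
        (cuspCoeff g ℓ - β') • (1 : Module.End ℂ (CuspForm (Gamma0 (M₀ * ℓ * q)) 2))) ^ m) (H s t) =
        (β' - t) ^ m • H s t := by
    intro s t ht hs
    rw [pow_sub_smul_one_apply_of_eigen _ (hUℓ s t ht hs) _ m,
      show cuspCoeff g ℓ - t - (cuspCoeff g ℓ - β') = β' - t by ring]
  have hβα : (β - α) ^ n ≠ 0 := pow_ne_zero _ (sub_ne_zero.mpr (Ne.symm hne))
  have hβα' : (β' - α') ^ m ≠ 0 := pow_ne_zero _ (sub_ne_zero.mpr (Ne.symm hne'))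
  -- (∗) `(U_q − α)^n k = 0` reads `c₂ (β−α)^n H α β′ + c₃ (β−α)^n H α α′ = 0`
  have hstar : (c 2 * (β - α) ^ n) • H α β' + (c 3 * (β - α) ^ n) • H α α' = 0 := by
    have h := hn
    rw [← hc, map_add, map_add, map_add, map_smul, map_smul, map_smul, map_smul,
      powq β β' (Or.inl rfl) (Or.inl rfl), powq β α' (Or.inr rfl) (Or.inl rfl),
      powq α β' (Or.inl rfl) (Or.inr rfl), powq α α' (Or.inr rfl) (Or.inr rfl), sub_self,
      zero_pow hnpos.ne', zero_smul, zero_smul, smul_zero, smul_zero, zero_add, zero_add, smul_smul, smul_smul] at h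
    exact h
  -- apply `(U_ℓ − α′)^m` to (∗): `c₃ = 0`
  have h3 : c 3 = 0 := by
    have h := congrArg ((heckeT (Gamma0 (M₀ * ℓ * q)) 2 ℓ -
      (cuspCoeff g ℓ - β') • (1 : Module.End ℂ (CuspForm (Gamma0 (M₀ * ℓ * q)) 2))) ^ m) hstar
    rw [map_zero, map_add, map_smul, map_smul, powℓ α β' (Or.inl rfl) (Or.inr rfl),
      powℓ α α' (Or.inr rfl) (Or.inr rfl), sub_self, zero_pow hmpos.ne', zero_smul, smul_zero, zero_add,
      smul_smul, smul_eq_zero] at h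
    rcases h with h | h
    · rcases mul_eq_zero.mp h with h | h
      · rcases mul_eq_zero.mp h with h | h
        · exact h
        · exact absurd h hβα
      · exact absurd h hβα'
    · exact absurd h (hH0 α α')
  -- back in (∗): `c₂ = 0`
  have h2 : c 2 = 0 := by
    have h := hstar
    rw [h3, zero_mul, zero_smul, add_zero, smul_eq_zero] at h
    rcases h with h | h
    · rcases mul_eq_zero.mp h with h | h
      · exact h
      · exact absurd h hβα
    · exact absurd h (hH0 α β')
  -- `(U_ℓ − α′)^m k = 0` reads `c₁ (β′−α′)^m H β α′ = 0` (using `c₃ = 0`): `c₁ = 0`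
  have h1 : c 1 = 0 := by
    have h := hm
    rw [← hc, map_add, map_add, map_add, map_smul, map_smul, map_smul, map_smul,
      powℓ β β' (Or.inl rfl) (Or.inl rfl), powℓ β α' (Or.inr rfl) (Or.inl rfl),
      powℓ α β' (Or.inl rfl) (Or.inr rfl), powℓ α α' (Or.inr rfl) (Or.inr rfl), sub_self,
      zero_pow hmpos.ne', zero_smul, zero_smul, smul_zero, smul_zero, zero_add, add_zero, h3, zero_smul, add_zero,
      smul_smul, smul_eq_zero] at h
    rcases h with h | h
    · rcases mul_eq_zero.mp h with h | h
      · exact h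
      · exact absurd h hβα'
    · exact absurd h (hH0 β α')
  refine ⟨c 0, ?_⟩
  rw [← hc, h1, h2, h3, zero_smul, zero_smul, zero_smul, add_zero, add_zero, add_zero]

end Double

end Summit.BirchSwinnertonDyer.BirchSwinnertonDyer.Theorems.KimAtThreeDeepLowerOffStratumLevelLoweringDoubleStabConditionOne

end
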